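import Literature.NumberTheory.ComplexMultiplication.MainTheoremOfComplexMultiplication
import HarnessLib

/-!
# The main theorem of complex multiplication read over a field of rationality `E ⊇ K*`
# ([Shimura 1998] Thm. 18.6 at `s = N_{E/K*}(y)`; §19.8 p. 134, §21.4 p. 147)

Theorems only (topic `NumberTheory/ComplexMultiplication`; no definition, no named fact, no instance).
The main theorem `shimura1998_thm18_6` (a named fact of the tree, here a HYPOTHESIS `h186`; it is a
theorem Summits-side, `Theorems.shimura1998_thm18_6_holds`) is stated for `σ ∈ Aut(ℂ/K*)` and an idèle
`s` of the reflex field `K* = traceField Φ` with «`σ = [s, K*]` on `K*_ab`».  Every consumer reads it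
over a LARGER number field `E ⊇ K*` — a field of rationality of the structure, or the field `E ⊇ ∏ E*(Φᵢ)`
of [Deligne 1971] 4.18–4.21 / [Milne 2005] (62) for a CM-algebra special pair — through the sentence
«since `σ = [y, E]` on `E_ab`, we have `σ = [N_{E/K*}(y), K*]` on `K*_ab`» ([Shimura 1998] proof of
Thm. 19.8 p. 134, proof of Thm. 21.4 p. 147; class field theory's norm functoriality, the tree's
`IsArtinLift.restrictScalars`).  This file states that reading ONCE, so that it is consumed by name:

* `shimura1998_thm18_6_of_isScalarTower` — for number fields `K* → E → ℂ` (abstract tower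
  `[Algebra (traceField Φ) E] [IsScalarTower (traceField Φ) E ℂ]`), `σ ∈ Aut(ℂ/E)`, `y ∈ E_𝐀^×` with
  «`σ = [y, E]` on `E_ab`»: there is a uniformisation `ξ′` of `(A^σ, ι^σ)` of type
  `(K, Φ, g(N_{E/K*} y)⁻¹ 𝔞)` with `ξ(q(u))^σ = ξ′(q(v))` whenever `g(N_{E/K*} y)⁻¹ (u mod 𝔞) = v`.
* `shimura1998_thm18_6_of_le` — the same for an intermediate field `E : IntermediateField ℚ ℂ` with
  `traceField Φ ≤ E` (the binder shape of `SiegelRationalModel.IsCanonical`; the `K*`-algebra structure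
  on `E` is the inclusion).
* `shimura1998_thm18_6_family`, `shimura1998_thm18_6_family_of_le` — for a finite (or any) family of
  structures `(Kᵢ, Φᵢ, 𝔞ᵢ, Aᵢ, ιᵢ, ξᵢ)` and ONE pair `(σ, y)` over `E ⊇ E*(Φᵢ)` for all `i`: the
  component-wise conclusion — the input of the CM-ALGEBRA case `F = ∏ Kᵢ` of the special pairs of
  [Deligne 1971] 4.18 (cell hodgecm-mathlib, census memo «#60 `SiegelS1`» §3 M3 (i); the `⊞`-packaging
  into ONE structure is moduli bookkeeping and is not done here).

Milne's convention «`art_E(t) = σ|E^ab`» for a FINITE idèle `t` (`UnitaryCanonicalModel.IsArtinCorrespondent`,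
the binder of `SiegelRationalModel.IsCanonical`) is Shimura's «`σ = [(1_∞, t)⁻¹, E]`»; for a CM field `E`
the tree's adapter is `isArtinCorrespondent_iff_isArtinLift` (`ArtinLiftVersusArtinCorrespondent`).

## References

* [Shimura1998] G. Shimura, *Abelian Varieties with Complex Multiplication and Modular Functions*
  (1998), §18.6 Thm. 18.6 (1)–(2) pp. 124–125; §19.8 Thm. 19.8 p. 134 (proof pp. 134–135); §21.4, proof of Thm. 21.4,
  p. 147 («σ = [N_{k/K*}(y), K*] on K*_ab»).
* [MilneCM2006] J. S. Milne, *Complex Multiplication*, Ch. II §9 Lemma 9.5 (norm functoriality).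
* [Deligne1971TravauxShimura] P. Deligne, *Travaux de Shimura*, 4.18–4.21 (CM-algebra special pairs).
-/

noncomputable section

open scoped Classical nonZeroDivisors NumberField
open CategoryTheory NumberField

namespace Literature.NumberTheory.ComplexMultiplication

open Literature.AlgebraicGeometry.Motives (CMType AbelianVariety)
open Literature.NumberTheory.GaloisRepresentations (ideleGroup)
open Literature.NumberTheory.NumberFields.IdeleAction (ideleMulEquiv)
open Literature.NumberTheory.AdelicBaseChange (ideleRelNorm)

/-! ## One structure, abstract tower `K* → E → ℂ` -/

/-- **[Shimura 1998, Thm. 18.6] read over a number field `E ⊇ K*`** (proof of Thm. 19.8 pp. 134–135 and of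
Thm. 21.4 p. 147: «since `σ = [y, k]` on `k_ab`, we have `σ = [N_{k/K*}(y), K*]` on `K*_ab`», then Thm. 18.6
at `s = N_{k/K*}(y)`).  Granted the main theorem (`h186`): for a CM field `K` with CM type `Φ`, reflex field
`K* = traceField Φ`, number fields `K* → E → ℂ` (`IsScalarTower`), a structure `(A, ι, ξ)` of type
`(K, Φ, 𝔞)`, `σ ∈ Aut(ℂ/E)` and an idèle `y` of `E` with «`σ = [y, E]` on `E_ab`» (`IsArtinLift E y σ`), there
is a uniformisation `ξ′` of `(A^σ, ι^σ)` of type `(K, Φ, g(N_{E/K*} y)⁻¹𝔞)` such that `ξ(q(u))^σ = ξ′(q(v))`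
whenever `g(N_{E/K*} y)⁻¹ · (u mod 𝔞) = v (mod g(N_{E/K*} y)⁻¹𝔞)` (18.3a).  Proof: `IsArtinLift.restrictScalars`
(norm functoriality of the Artin map, proved in the tree) and `h186` at `σ|_{Aut(ℂ/K*)}`, `s = N_{E/K*} y`.
[cite: Shimura1998, §18.6 Thm. 18.6 (1)–(2) pp. 124–125; §19.8 Thm. 19.8 p. 134 (proof pp. 134–135); §21.4, proof of Thm. 21.4, p. 147]
[cite: MilneCM2006, Ch. II §9 Lemma 9.5] -/
theorem shimura1998_thm18_6_of_isScalarTower (h186 : shimura1998_thm18_6)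
    (K : Type) [Field K] [NumberField K] [IsCMField K] (Φ : CMType K) [NumberField (traceField Φ)]
    {E : Type} [Field E] [NumberField E] [Algebra E ℂ] [Algebra (traceField Φ) E]
    [IsScalarTower (traceField Φ) E ℂ]
    (𝔞 : (FractionalIdeal (𝓞 K)⁰ K)ˣ) (A : AbelianVariety ℂ) (ι : 𝓞 K →+* End A)
    (ξ : CMTypeUniformization Φ 𝔞 A ι) (σ : ℂ ≃ₐ[E] ℂ) (y : ideleGroup E) (hy : IsArtinLift E y σ) :
    ∃ ξ' : CMTypeUniformization Φ
        (ideleMulIdealUnits (reflexNormFinitePart K Φ (traceField Φ) (ideleRelNorm (traceField Φ) E y))⁻¹ 𝔞)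
        (A.conjugate σ.toRingEquiv) ((A.endConjugate σ.toRingEquiv).comp ι),
      ∀ u v : K,
        ideleMulEquiv (reflexNormFinitePart K Φ (traceField Φ) (ideleRelNorm (traceField Φ) E y))⁻¹
            (𝔞 : FractionalIdeal (𝓞 K)⁰ K) 𝔞.ne_zero (Submodule.Quotient.mk u) = Submodule.Quotient.mk v →
          A.conjPoints σ.toRingEquiv (ξ.r u) = ξ'.r v :=
  h186 K Φ 𝔞 A ι ξ (σ.restrictScalars (traceField Φ)) (ideleRelNorm (traceField Φ) E y)
    (hy.restrictScalars (traceField Φ))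

/-! ## One structure, `E : IntermediateField ℚ ℂ` with `traceField Φ ≤ E` -/

/-- **[Shimura 1998, Thm. 18.6] read over an intermediate field `E ⊇ K*` of `ℂ/ℚ`** — the binder shape
of [Deligne 1971] 4.18–4.21 / [Milne 2005] (62) as typed in `SiegelRationalModel.IsCanonical`
(`E : IntermediateField ℚ ℂ`, `traceField Φ ≤ E`, `σ : ℂ ≃ₐ[E] ℂ`): with the `K*`-algebra structure on `E`
given by the inclusion `traceField Φ ≤ E`, the conclusion of `shimura1998_thm18_6_of_isScalarTower` at
`s = N_{E/K*}(y)`. [cite: Shimura1998, §18.6 Thm. 18.6 (1)–(2) pp. 124–125; §21.4, proof of Thm. 21.4, p. 147]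
[cite: Deligne1971TravauxShimura, 4.18–4.21 pp. 150–152] -/
theorem shimura1998_thm18_6_of_le (h186 : shimura1998_thm18_6)
    (K : Type) [Field K] [NumberField K] [IsCMField K] (Φ : CMType K) [NumberField (traceField Φ)]
    (E : IntermediateField ℚ ℂ) [NumberField E] (hE : traceField Φ ≤ E)
    (𝔞 : (FractionalIdeal (𝓞 K)⁰ K)ˣ) (A : AbelianVariety ℂ) (ι : 𝓞 K →+* End A)
    (ξ : CMTypeUniformization Φ 𝔞 A ι) (σ : ℂ ≃ₐ[E] ℂ) (y : ideleGroup E) (hy : IsArtinLift E y σ) :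
    letI : Algebra (traceField Φ) E := (IntermediateField.inclusion hE).toRingHom.toAlgebra
    ∃ ξ' : CMTypeUniformization Φ
        (ideleMulIdealUnits (reflexNormFinitePart K Φ (traceField Φ) (ideleRelNorm (traceField Φ) E y))⁻¹ 𝔞)
        (A.conjugate σ.toRingEquiv) ((A.endConjugate σ.toRingEquiv).comp ι),
      ∀ u v : K,
        ideleMulEquiv (reflexNormFinitePart K Φ (traceField Φ) (ideleRelNorm (traceField Φ) E y))⁻¹
            (𝔞 : FractionalIdeal (𝓞 K)⁰ K) 𝔞.ne_zero (Submodule.Quotient.mk u) = Submodule.Quotient.mk v →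
          A.conjPoints σ.toRingEquiv (ξ.r u) = ξ'.r v := by
  letI : Algebra (traceField Φ) E := (IntermediateField.inclusion hE).toRingHom.toAlgebra
  haveI : IsScalarTower (traceField Φ) E ℂ := IsScalarTower.of_algebraMap_eq fun _ => rfl
  exact shimura1998_thm18_6_of_isScalarTower h186 K Φ 𝔞 A ι ξ σ y hy

/-! ## A family of structures and one pair `(σ, y)` -/

/-- **[Shimura 1998, Thm. 18.6] for a family of structures over a common field `E ⊇ E*(Φᵢ)`** (the
component-wise form in which the CM-ALGEBRA special pairs `F = ∏ Kᵢ` of [Deligne 1971] 4.18 consume it;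
abstract towers `K*ᵢ → E → ℂ`): for structures `(Aᵢ, ιᵢ, ξᵢ)` of types `(Kᵢ, Φᵢ, 𝔞ᵢ)`, `σ ∈ Aut(ℂ/E)` and an
idèle `y` of `E` with «`σ = [y, E]` on `E_ab`», there are uniformisations `ξ′ᵢ` of `(Aᵢ^σ, ιᵢ^σ)` of types
`(Kᵢ, Φᵢ, gᵢ(N_{E/K*ᵢ} y)⁻¹𝔞ᵢ)` with `ξᵢ(qᵢ(u))^σ = ξ′ᵢ(qᵢ(v))` under (18.3a), for every `i`
(`shimura1998_thm18_6_of_isScalarTower` component-wise). [cite: Shimura1998, §18.6 Thm. 18.6 (1)–(2) pp. 124–125; §21.4, proof of Thm. 21.4, p. 147]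
[cite: Deligne1971TravauxShimura, 4.18 p. 150 («L est un produit de corps CM»)] -/
theorem shimura1998_thm18_6_family (h186 : shimura1998_thm18_6)
    {I : Type} (K : I → Type) [∀ i, Field (K i)] [∀ i, NumberField (K i)] [∀ i, IsCMField (K i)]
    (Φ : ∀ i, CMType (K i)) [∀ i, NumberField (traceField (Φ i))]
    {E : Type} [Field E] [NumberField E] [Algebra E ℂ] [∀ i, Algebra (traceField (Φ i)) E]
    [∀ i, IsScalarTower (traceField (Φ i)) E ℂ]
    (𝔞 : ∀ i, (FractionalIdeal (𝓞 (K i))⁰ (K i))ˣ) (A : I → AbelianVariety ℂ)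
    (ιA : ∀ i, 𝓞 (K i) →+* End (A i)) (ξ : ∀ i, CMTypeUniformization (Φ i) (𝔞 i) (A i) (ιA i))
    (σ : ℂ ≃ₐ[E] ℂ) (y : ideleGroup E) (hy : IsArtinLift E y σ) :
    ∃ ξ' : ∀ i, CMTypeUniformization (Φ i)
        (ideleMulIdealUnits
          (reflexNormFinitePart (K i) (Φ i) (traceField (Φ i)) (ideleRelNorm (traceField (Φ i)) E y))⁻¹ (𝔞 i))
        ((A i).conjugate σ.toRingEquiv) (((A i).endConjugate σ.toRingEquiv).comp (ιA i)),
      ∀ (i : I) (u v : K i),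
        ideleMulEquiv
            (reflexNormFinitePart (K i) (Φ i) (traceField (Φ i)) (ideleRelNorm (traceField (Φ i)) E y))⁻¹
            (𝔞 i : FractionalIdeal (𝓞 (K i))⁰ (K i)) (𝔞 i).ne_zero (Submodule.Quotient.mk u) =
            Submodule.Quotient.mk v →
          (A i).conjPoints σ.toRingEquiv ((ξ i).r u) = (ξ' i).r v := by
  choose ξ' hξ' using fun i =>
    shimura1998_thm18_6_of_isScalarTower h186 (K i) (Φ i) (𝔞 i) (A i) (ιA i) (ξ i) σ y hy
  exact ⟨ξ', hξ'⟩

/-- **[Shimura 1998, Thm. 18.6] for a family of structures over an intermediate field `E ⊇ E*(Φᵢ)` of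
`ℂ/ℚ`** — the binder shape `∀ (E : IntermediateField ℚ ℂ) …, (∀ i, traceField (Φ i) ≤ E) → ∀ (σ : ℂ ≃ₐ[E] ℂ) …`
of `SiegelRationalModel.IsCanonical` ([Deligne 1971] 4.18–4.21, [Milne 2005] (62)); the `K*ᵢ`-algebra
structures on `E` are the inclusions. [cite: Shimura1998, §18.6 Thm. 18.6 (1)–(2) pp. 124–125; §21.4, proof of Thm. 21.4, p. 147]
[cite: Deligne1971TravauxShimura, 4.18–4.21 pp. 150–152] -/
theorem shimura1998_thm18_6_family_of_le (h186 : shimura1998_thm18_6)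
    {I : Type} (K : I → Type) [∀ i, Field (K i)] [∀ i, NumberField (K i)] [∀ i, IsCMField (K i)]
    (Φ : ∀ i, CMType (K i)) [∀ i, NumberField (traceField (Φ i))]
    (E : IntermediateField ℚ ℂ) [NumberField E] (hE : ∀ i, traceField (Φ i) ≤ E)
    (𝔞 : ∀ i, (FractionalIdeal (𝓞 (K i))⁰ (K i))ˣ) (A : I → AbelianVariety ℂ)
    (ιA : ∀ i, 𝓞 (K i) →+* End (A i)) (ξ : ∀ i, CMTypeUniformization (Φ i) (𝔞 i) (A i) (ιA i))
    (σ : ℂ ≃ₐ[E] ℂ) (y : ideleGroup E) (hy : IsArtinLift E y σ) :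
    letI : ∀ i, Algebra (traceField (Φ i)) E := fun i =>
      (IntermediateField.inclusion (hE i)).toRingHom.toAlgebra
    ∃ ξ' : ∀ i, CMTypeUniformization (Φ i)
        (ideleMulIdealUnits
          (reflexNormFinitePart (K i) (Φ i) (traceField (Φ i)) (ideleRelNorm (traceField (Φ i)) E y))⁻¹ (𝔞 i))
        ((A i).conjugate σ.toRingEquiv) (((A i).endConjugate σ.toRingEquiv).comp (ιA i)),
      ∀ (i : I) (u v : K i),
        ideleMulEquiv
            (reflexNormFinitePart (K i) (Φ i) (traceField (Φ i)) (ideleRelNorm (traceField (Φ i)) E y))⁻¹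
            (𝔞 i : FractionalIdeal (𝓞 (K i))⁰ (K i)) (𝔞 i).ne_zero (Submodule.Quotient.mk u) =
            Submodule.Quotient.mk v →
          (A i).conjPoints σ.toRingEquiv ((ξ i).r u) = (ξ' i).r v := by
  letI : ∀ i, Algebra (traceField (Φ i)) E := fun i =>
    (IntermediateField.inclusion (hE i)).toRingHom.toAlgebra
  haveI : ∀ i, IsScalarTower (traceField (Φ i)) E ℂ := fun i =>
    IsScalarTower.of_algebraMap_eq fun _ => rfl
  exact shimura1998_thm18_6_family h186 K Φ 𝔞 A ιA ξ σ y hy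

end Literature.NumberTheory.ComplexMultiplication

end
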